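import Summits.QuantumFields.YangMills.Theorems.BalabanUVNodesN15ColouredUnitBondDictionary
import Summits.QuantumFields.YangMills.Theorems.BalabanUVNodesN15UnitLayerBgExactDressing
import HarnessLib

/-!
# N15 (NE2) — PROGRAMME Σ-col, part (H): ★★★ THE LETTERS OF THE EXACT (1.103) DRESSING ON A COLOURED CARRIER — V-B's finite Combes–Thomas letters (`abs_exDress_le` ∕ `abs_exDress_sub_le`,
# generic) instantiated on the coloured bond index `B4.Idx (pbox M) (d+1) × ι` with the (1.66) matrix ⊗ colour `Δ^{(n)} ⊗ₖ 1` and the lifted metric `cdist`: the coloured twin of V-C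
# `exDress_deltaPol_letters`, uniform in the torus, the level and every colour type of cardinality `≤ N_c`

WHO ∕ WHEN.  Cell `pub-ymgap`, seat `pub-ymgap-dag-n15-a` (KNIT-BY-NAME seat of Track-A DAG node N15 = NE2, g28); `--kind proof --supports stmt-QuantumFields-27366 --as helper` (K3⁸;
count-neutral).  THEOREMS ONLY (0 `def`).  Over (G) `…N15ColouredUnitBondDictionary` (`cdist` + its pseudo-metric facts, `colSum_le`, `kernelDecay166_col`, `kernelRate166_col`,
`form_deltaCol_nonneg`, `deltaCol_isSymm`) and V-B `…UnitLayerBgExactDressing` (`exDress`, `exDress_isSymm`, ★★★ `abs_exDress_le`, ★★★ `abs_exDress_sub_le`) BY NAME; the proof is V-C's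
(p577812) VERBATIM with the scalar rows replaced by the coloured ones (row sums `× N_c`); nothing in the tree is modified.

WHAT.  ★★★ `exDress_deltaCol_letters (Nc) (hb : 0 < b) (hδZ : 0 < δZ) : ∃ K δ′ ζ₀ > 0, ∀ M ι (|ι| ≤ N_c) n₁ n₂ R (1 ≤ n₁, n₂ = R·n₁) Z Z′ ζ τ (0 ≤ ζ ≤ ζ₀, 0 ≤ τ), letters of Z, Z′, Z′−Z at
rate δ_Z ⟹ exDress b (Δ^{(n₁)} ⊗ₖ 1) Z, exDress b (Δ^{(n₂)} ⊗ₖ 1) Z′ symmetric ∧ (i) |·| ≤ Kζe^{−δ′cdist} ∧ (ii) same ∧ (iii) |difference| ≤ K(τ + n₁⁻¹)e^{−δ′cdist}` — U-B's OUTPUT SHAPE on the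
coloured carrier; the input a producer supplies is the middle factor `Z(A) = unitBondMatC ((Q⊗1)(𝒢(A) − 𝒢(0))(Q*⊗1))`'s three letters (Σ-col (I), not here).

HONEST FRAMING ∕ LIMITS.  Bookkeeping over landed rows (V-B's mechanism = King (4.40)–(4.41) + finite Combes–Thomas); NO layer of NE2 is proved here; (I)–(J) do not exist yet; dag-n15-c's
family, Bałaban's non-abelian `G(U)`, the N15 claim of record (I.44870) and every count untouched (typed 28∕28 · discharged 7∕28 = 7∕27 excl. NODE O); K3⁸ OPEN; one finite 𝕋⁴ at fixed
ε — NOT ℝ⁴ ∕ infinite volume ∕ OS ∕ mass gap ∕ Clay.  No `sorry`, `instance`, `notation`, `maxHeartbeats`; standard axioms.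
-/

noncomputable section

open scoped BigOperators Matrix Kronecker

namespace Summit.QuantumFields.YangMills.BalabanUVNodes.N15.UnitLayerBgCol

open Literature.MathematicalPhysics.QuantumFieldTheory.Balaban1983to89
open Literature.MathematicalPhysics.QuantumFieldTheory.King1986 (exp_decay_mono)
open Literature.MathematicalPhysics.QuantumFieldTheory.Balaban1983to89.B5Prop11Plancherel (Tor fine)
open Literature.MathematicalPhysics.QuantumFieldTheory.Balaban1983to89.B6Lemma24Torus (pbox)
open Literature.MathematicalPhysics.QuantumFieldTheory.Balaban1983to89.B6Cov2156Torus (deltaPol deltaPol_isSymm one_le_M)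
open Literature.MathematicalPhysics.QuantumFieldTheory.Balaban1983to89.B4Sect5Proof (latticeConst latticeConst_nonneg)
open Literature.MathematicalPhysics.QuantumFieldTheory.Balaban1983to89.QGQInverse (Coercive isUnit_of_coercive)
open Summit.QuantumFields.YangMills.BalabanUVNodes.N15.UnitLayerBg (exDress exDress_isSymm abs_exDress_le abs_exDress_sub_le)

variable (d : ℕ)
set_option maxHeartbeats 400000 in
/-- ★★★ **THE LETTERS OF THE EXACT (1.103) DRESSING OF THE COLOUR-LIFTED (1.66) MATRIX, UNIFORM.**  Let `b > 0`, a middle-factor rate `δ_Z > 0` and a colour bound `N_c`.  There are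
`K, δ′, ζ₀ > 0` (depending on `d, b, δ_Z, N_c` only) such that for EVERY unit torus `M`, EVERY colour type `ι` with `|ι| ≤ N_c`, ALL levels `n₁ ≥ 1`, `n₂ = R·n₁` and ALL middle factors
`Z, Z′` on the coloured bonds with `|Z|, |Z′| ≤ ζ·e^{−δ_Z·cdist}` (`0 ≤ ζ ≤ ζ₀`) and `|Z′ − Z| ≤ τ·e^{−δ_Z·cdist}` (`τ ≥ 0`): `exDress b (Δ^{(n₁)} ⊗ₖ 1) Z` and `exDress b (Δ^{(n₂)} ⊗ₖ 1) Z′` are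
symmetric, (i) `|exDress b (Δ^{(n₁)} ⊗ₖ 1) Z| ≤ K·ζ·e^{−δ′cdist}`, (ii) the same for `(n₂, Z′)`, (iii) `|exDress b (Δ^{(n₂)} ⊗ₖ 1) Z′ − exDress b (Δ^{(n₁)} ⊗ₖ 1) Z| ≤ K·(τ + n₁⁻¹)·e^{−δ′cdist}`
— V-C's theorem on the coloured carrier (inputs (G) `kernelDecay166_col`, `kernelRate166_col`, `form_deltaCol_nonneg`, `colSum_le`, V-B). [cite: Balaban1984PropagatorsI, (1.66) p.29,
(1.103) p.34 (objects); King1986, (4.40)–(4.41) pp.674–675 (mechanism); CombesThomas1973, §II (mechanism)] [folklore] -/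
theorem exDress_deltaCol_letters (Nc : ℕ) {b : ℝ} (hb : 0 < b) {δZ : ℝ} (hδZ : 0 < δZ) :
    ∃ K δ' ζ₀ : ℝ, 0 < K ∧ 0 < δ' ∧ 0 < ζ₀ ∧
      ∀ (M : Fin (d + 1) → ℕ) [∀ μ, NeZero (M μ)] (ι : Type) [Fintype ι] [DecidableEq ι], Fintype.card ι ≤ Nc →
      ∀ (n₁ n₂ R : ℕ), 1 ≤ n₁ → 1 ≤ R → n₂ = R * n₁ →
        ∀ (Z Z' : Matrix (B4.Idx (pbox M) (d + 1) × ι) (B4.Idx (pbox M) (d + 1) × ι) ℝ) (ζ τ : ℝ), 0 ≤ ζ → ζ ≤ ζ₀ → 0 ≤ τ →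
        (∀ p q : B4.Idx (pbox M) (d + 1) × ι, |Z p q| ≤ ζ * Real.exp (-(δZ * cdist M ι p q))) →
        (∀ p q : B4.Idx (pbox M) (d + 1) × ι, |Z' p q| ≤ ζ * Real.exp (-(δZ * cdist M ι p q))) →
        (∀ p q : B4.Idx (pbox M) (d + 1) × ι, |Z' p q - Z p q| ≤ τ * Real.exp (-(δZ * cdist M ι p q))) →
        (exDress b (deltaPol M n₁ ⊗ₖ (1 : Matrix ι ι ℝ)) Z).IsSymm ∧ (exDress b (deltaPol M n₂ ⊗ₖ (1 : Matrix ι ι ℝ)) Z').IsSymm ∧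
        (∀ p q : B4.Idx (pbox M) (d + 1) × ι, |exDress b (deltaPol M n₁ ⊗ₖ (1 : Matrix ι ι ℝ)) Z p q|
            ≤ K * ζ * Real.exp (-(δ' * cdist M ι p q))) ∧
        (∀ p q : B4.Idx (pbox M) (d + 1) × ι, |exDress b (deltaPol M n₂ ⊗ₖ (1 : Matrix ι ι ℝ)) Z' p q|
            ≤ K * ζ * Real.exp (-(δ' * cdist M ι p q))) ∧
        (∀ p q : B4.Idx (pbox M) (d + 1) × ι, |exDress b (deltaPol M n₂ ⊗ₖ (1 : Matrix ι ι ℝ)) Z' p q - exDress b (deltaPol M n₁ ⊗ₖ (1 : Matrix ι ι ℝ)) Z p q|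
            ≤ K * (τ + (n₁ : ℝ)⁻¹) * Real.exp (-(δ' * cdist M ι p q))) := by
  obtain ⟨c₀, δ₀, hc₀, hδ₀, hK⟩ := kernelDecay166_col d (by omega)
  obtain ⟨θ₀, δ₁, hθ₀, hδ₁, hR⟩ := kernelRate166_col d (by omega)
  -- the common input rate κ
  obtain ⟨κ, hκdef⟩ : ∃ κ : ℝ, κ = min (min δ₀ δ₁) δZ := ⟨_, rfl⟩
  have hκ : 0 < κ := by rw [hκdef]; exact lt_min (lt_min hδ₀ hδ₁) hδZ
  have hκδ₀ : κ ≤ δ₀ := by rw [hκdef]; exact (min_le_left _ _).trans (min_le_left _ _)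
  have hκδ₁ : κ ≤ δ₁ := by rw [hκdef]; exact (min_le_left _ _).trans (min_le_right _ _)
  have hκZ : κ ≤ δZ := by rw [hκdef]; exact min_le_right _ _
  have hd0 : (0 : ℝ) < (d : ℝ) + 1 := by positivity
  have hNc : (0 : ℝ) ≤ (Nc : ℝ) := Nat.cast_nonneg _
  -- stage S constants
  obtain ⟨V₁, hV₁def⟩ : ∃ V : ℝ, V = (Nc : ℝ) * (((d : ℝ) + 1) * latticeConst (d + 1) (κ / 4)) := ⟨_, rfl⟩
  have hV₁0 : 0 ≤ V₁ := by rw [hV₁def]; exact mul_nonneg hNc (mul_nonneg hd0.le (latticeConst_nonneg (d + 1) (by positivity)))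
  obtain ⟨κ₁, hκ₁def⟩ : ∃ κ₁ : ℝ, κ₁ = min (κ / 4) (b * κ / (4 * (b + c₀) * V₁ + 1)) := ⟨_, rfl⟩
  have hκ₁ : 0 < κ₁ := by rw [hκ₁def]; exact lt_min (by positivity) (by positivity)
  have hκ₁κ : κ₁ ≤ κ / 4 := by rw [hκ₁def]; exact min_le_left _ _
  have hs₁ : 4 * (b + c₀) * V₁ * κ₁ ≤ b * κ := by
    have h1 : κ₁ ≤ b * κ / (4 * (b + c₀) * V₁ + 1) := by rw [hκ₁def]; exact min_le_right _ _
    have h2 : 4 * (b + c₀) * V₁ * κ₁ ≤ (4 * (b + c₀) * V₁ + 1) * κ₁ := by nlinarith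
    have h3 : (4 * (b + c₀) * V₁ + 1) * κ₁ ≤ b * κ := by
      have := mul_le_mul_of_nonneg_left h1 (by positivity : (0 : ℝ) ≤ 4 * (b + c₀) * V₁ + 1)
      rwa [mul_div_cancel₀ _ (by positivity : (4 * (b + c₀) * V₁ + 1 : ℝ) ≠ 0)] at this
    exact h2.trans h3
  obtain ⟨γS, hγS⟩ : ∃ γS : ℝ, γS = b / ((b + c₀) * V₁ + 1) ^ 2 := ⟨_, rfl⟩
  -- stage T constants
  obtain ⟨V₂, hV₂def⟩ : ∃ V : ℝ, V = (Nc : ℝ) * (((d : ℝ) + 1) * latticeConst (d + 1) (κ₁ / 4)) := ⟨_, rfl⟩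
  have hV₂0 : 0 ≤ V₂ := by rw [hV₂def]; exact mul_nonneg hNc (mul_nonneg hd0.le (latticeConst_nonneg (d + 1) (by positivity)))
  obtain ⟨ζ₀, hζ₀def⟩ : ∃ ζ₀ : ℝ, ζ₀ = γS / (2 * V₂ + 1) := ⟨_, rfl⟩
  obtain ⟨κ₂, hκ₂def⟩ : ∃ κ₂ : ℝ, κ₂ = min (κ₁ / 4) (γS * κ₁ / (8 * (2 / b + ζ₀) * V₂ + 1)) := ⟨_, rfl⟩
  obtain ⟨V₃, hV₃def⟩ : ∃ V : ℝ, V = (Nc : ℝ) * (((d : ℝ) + 1) * latticeConst (d + 1) (κ₂ / 2)) := ⟨_, rfl⟩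
  have hγpos : 0 < γS := by rw [hγS]; positivity
  have hζ₀ : 0 < ζ₀ := by rw [hζ₀def]; positivity
  have hκ₂ : 0 < κ₂ := by rw [hκ₂def]; exact lt_min (by positivity) (by positivity)
  have hκ₂κ : κ₂ ≤ κ₁ / 4 := by rw [hκ₂def]; exact min_le_left _ _
  have hV₃0 : 0 ≤ V₃ := by rw [hV₃def]; exact mul_nonneg hNc (mul_nonneg hd0.le (latticeConst_nonneg (d + 1) (by positivity)))
  have hs₂ : ∀ {ζ : ℝ}, 0 ≤ ζ → ζ ≤ ζ₀ → ζ * V₂ ≤ γS / 2 := fun {ζ} hζ hζle => by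
    have h1 : ζ * V₂ ≤ ζ₀ * V₂ := mul_le_mul_of_nonneg_right hζle hV₂0
    have h2 : ζ₀ * V₂ ≤ γS / 2 := by
      rw [hζ₀def, div_mul_eq_mul_div, div_le_iff₀ (by positivity)]
      nlinarith
    exact h1.trans h2
  have hs₃ : ∀ {ζ : ℝ}, 0 ≤ ζ → ζ ≤ ζ₀ → 8 * (2 / b + ζ) * V₂ * κ₂ ≤ γS * κ₁ := fun {ζ} hζ hζle => by
    have h1 : κ₂ ≤ γS * κ₁ / (8 * (2 / b + ζ₀) * V₂ + 1) := by rw [hκ₂def]; exact min_le_right _ _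
    have h2 : 8 * (2 / b + ζ) * V₂ * κ₂ ≤ (8 * (2 / b + ζ₀) * V₂ + 1) * κ₂ := by
      have : 8 * (2 / b + ζ) * V₂ ≤ 8 * (2 / b + ζ₀) * V₂ := by nlinarith
      nlinarith
    have h3 : (8 * (2 / b + ζ₀) * V₂ + 1) * κ₂ ≤ γS * κ₁ := by
      have := mul_le_mul_of_nonneg_left h1 (by positivity : (0 : ℝ) ≤ 8 * (2 / b + ζ₀) * V₂ + 1)
      rwa [mul_div_cancel₀ _ (by positivity : (8 * (2 / b + ζ₀) * V₂ + 1 : ℝ) ≠ 0)] at this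
    exact h2.trans h3
  -- the constant K majorises every amplitude
  obtain ⟨K, hKdef⟩ : ∃ K : ℝ, K = (b + c₀) * (4 / γS) * V₃ ^ 2 + (4 / γS) ^ 2 * V₃ ^ 2 * ((2 / b) ^ 2 * V₂ ^ 2 * θ₀ + 1) + θ₀ + 1 := ⟨_, rfl⟩
  have hKpos : 0 < K := by rw [hKdef]; positivity
  have hT1 : 0 ≤ (b + c₀) * (4 / γS) * V₃ ^ 2 := by positivity
  have hT2 : 0 ≤ (4 / γS) ^ 2 * V₃ ^ 2 * ((2 / b) ^ 2 * V₂ ^ 2 * θ₀ + 1) := by positivity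
  have hT1K : (b + c₀) * (4 / γS) * V₃ ^ 2 ≤ K := by rw [hKdef]; linarith
  refine ⟨K, κ₂ / 2, ζ₀, hKpos, half_pos hκ₂, hζ₀, ?_⟩
  intro M _ ι _ _ hι n₁ n₂ R' hn₁ hR1 h Z Z' ζ τ hζ hζle hτ hZ hZ' hZZ
  have hιr : (Fintype.card ι : ℝ) ≤ Nc := by exact_mod_cast hι
  set ρ : B4.Idx (pbox M) (d + 1) × ι → B4.Idx (pbox M) (d + 1) × ι → ℝ := fun p q => cdist M ι p q with hρdef
  have hρ0 : ∀ p, ρ p p = 0 := fun p => cdist_self M ι p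
  have hρn : ∀ p q, 0 ≤ ρ p q := fun p q => cdist_nonneg M ι p q
  have hρs : ∀ p q, ρ p q = ρ q p := fun p q => cdist_comm M ι p q
  have hρt : ∀ p q r, ρ p r ≤ ρ p q + ρ q r := fun p q r => cdist_triangle M ι p q r
  have hn₂ : 1 ≤ n₂ := by subst h; exact Nat.one_le_iff_ne_zero.mpr (Nat.mul_ne_zero (by omega) (by omega))
  haveI : NeZero n₁ := ⟨by omega⟩
  haveI : NeZero n₂ := ⟨by omega⟩
  have hΔ₁ : ∀ p q, |(deltaPol M n₁ ⊗ₖ (1 : Matrix ι ι ℝ)) p q| ≤ c₀ * Real.exp (-(κ * ρ p q)) := fun p q => (hK M ι n₁ hn₁ p q).trans (exp_decay_mono hc₀.le hκδ₀ (hρn p q))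
  have hΔ₂ : ∀ p q, |(deltaPol M n₂ ⊗ₖ (1 : Matrix ι ι ℝ)) p q| ≤ c₀ * Real.exp (-(κ * ρ p q)) := fun p q => (hK M ι n₂ hn₂ p q).trans (exp_decay_mono hc₀.le hκδ₀ (hρn p q))
  have hθn : 0 ≤ θ₀ * (n₁ : ℝ)⁻¹ := mul_nonneg hθ₀.le (inv_nonneg.mpr (Nat.cast_nonneg _))
  have hΔΔ : ∀ p q, |(deltaPol M n₂ ⊗ₖ (1 : Matrix ι ι ℝ)) p q - (deltaPol M n₁ ⊗ₖ (1 : Matrix ι ι ℝ)) p q| ≤ θ₀ * (n₁ : ℝ)⁻¹ * Real.exp (-(κ * ρ p q)) := fun p q =>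
    (hR M ι n₁ n₂ R' hn₁ hR1 h p q).trans (exp_decay_mono hθn hκδ₁ (hρn p q))
  have hZκ : ∀ p q, |Z p q| ≤ ζ * Real.exp (-(κ * ρ p q)) := fun p q => (hZ p q).trans (exp_decay_mono hζ hκZ (hρn p q))
  have hZ'κ : ∀ p q, |Z' p q| ≤ ζ * Real.exp (-(κ * ρ p q)) := fun p q => (hZ' p q).trans (exp_decay_mono hζ hκZ (hρn p q))
  have hZZκ : ∀ p q, |Z' p q - Z p q| ≤ τ * Real.exp (-(κ * ρ p q)) := fun p q => (hZZ p q).trans (exp_decay_mono hτ hκZ (hρn p q))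
  have hP₁ : ∀ x, 0 ≤ x ⬝ᵥ ((deltaPol M n₁ ⊗ₖ (1 : Matrix ι ι ℝ)) *ᵥ x) := form_deltaCol_nonneg M ι n₁ hn₁
  have hP₂ : ∀ x, 0 ≤ x ⬝ᵥ ((deltaPol M n₂ ⊗ₖ (1 : Matrix ι ι ℝ)) *ᵥ x) := form_deltaCol_nonneg M ι n₂ hn₂
  have hW : ∀ {a : ℝ}, 0 < a → ∀ p, ∑ q, Real.exp (-(a * ρ p q)) ≤ (Nc : ℝ) * (((d : ℝ) + 1) * latticeConst (d + 1) a) := fun {a} ha p =>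
    (colSum_le M ι ha p).trans (mul_le_mul_of_nonneg_right hιr (mul_nonneg hd0.le (latticeConst_nonneg (d + 1) ha.le)))
  have hW₁ : ∀ p, ∑ q, Real.exp (-(κ / 4 * ρ p q)) ≤ V₁ := fun p => by rw [hV₁def]; exact hW (by positivity) p
  have hW₂ : ∀ p, ∑ q, Real.exp (-(κ₁ / 4 * ρ p q)) ≤ V₂ := fun p => by rw [hV₂def]; exact hW (by positivity) p
  have hW₃ : ∀ p, ∑ q, Real.exp (-(κ₂ / 2 * ρ p q)) ≤ V₃ := fun p => by rw [hV₃def]; exact hW (by positivity) p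
  refine ⟨exDress_isSymm b (deltaCol_isSymm M ι n₁) Z, exDress_isSymm b (deltaCol_isSymm M ι n₂) Z', fun p q => ?_, fun p q => ?_, fun p q => ?_⟩
  · refine (abs_exDress_le ρ hρn hρs hρ0 hρt hb hc₀.le hκ hκ₁ hκ₁κ hκ₂.le hκ₂κ hζ hP₁ hΔ₁ hZκ hW₁ hW₂ hW₃ hγS hs₁ (hs₂ hζ hζle) (hs₃ hζ hζle) p q).trans ?_
    refine mul_le_mul_of_nonneg_right ?_ (Real.exp_nonneg _)
    have : (b + c₀) * ζ * (4 / γS) * V₃ ^ 2 = ((b + c₀) * (4 / γS) * V₃ ^ 2) * ζ := by ring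
    rw [this]
    refine mul_le_mul_of_nonneg_right ?_ hζ
    exact hT1K
  · refine (abs_exDress_le ρ hρn hρs hρ0 hρt hb hc₀.le hκ hκ₁ hκ₁κ hκ₂.le hκ₂κ hζ hP₂ hΔ₂ hZ'κ hW₁ hW₂ hW₃ hγS hs₁ (hs₂ hζ hζle) (hs₃ hζ hζle) p q).trans ?_
    refine mul_le_mul_of_nonneg_right ?_ (Real.exp_nonneg _)
    have : (b + c₀) * ζ * (4 / γS) * V₃ ^ 2 = ((b + c₀) * (4 / γS) * V₃ ^ 2) * ζ := by ring
    rw [this]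
    refine mul_le_mul_of_nonneg_right ?_ hζ
    exact hT1K
  · refine (abs_exDress_sub_le ρ hρn hρs hρ0 hρt hb hc₀.le hκ hκ₁ hκ₁κ hκ₂.le hκ₂κ hζ hθn hτ hP₁ hΔ₁ hP₂ hΔ₂ hZκ hZ'κ hΔΔ hZZκ hW₁ hW₂ hW₃ hγS hs₁
      (hs₂ hζ hζle) (hs₃ hζ hζle) p q).trans ?_
    refine mul_le_mul_of_nonneg_right ?_ (Real.exp_nonneg _)
    have hn0 : 0 ≤ (n₁ : ℝ)⁻¹ := inv_nonneg.mpr (Nat.cast_nonneg _)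
    -- each coefficient is ≤ K
    have hx : 0 ≤ (4 / γS) ^ 2 * V₃ ^ 2 * ((2 / b) ^ 2 * V₂ ^ 2 * θ₀) := by positivity
    have hy : 0 ≤ (4 / γS) ^ 2 * V₃ ^ 2 := by positivity
    have hsplit : (4 / γS) ^ 2 * V₃ ^ 2 * ((2 / b) ^ 2 * V₂ ^ 2 * θ₀ + 1) = (4 / γS) ^ 2 * V₃ ^ 2 * ((2 / b) ^ 2 * V₂ ^ 2 * θ₀) + (4 / γS) ^ 2 * V₃ ^ 2 := by ring
    have hB : (4 / γS) ^ 2 * V₃ ^ 2 ≤ K := by rw [hKdef, hsplit]; linarith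
    have hAC : (4 / γS) ^ 2 * V₃ ^ 2 * ((2 / b) ^ 2 * V₂ ^ 2 * θ₀) + θ₀ ≤ K := by rw [hKdef, hsplit]; linarith
    calc (4 / γS) ^ 2 * V₃ ^ 2 * ((2 / b) ^ 2 * V₂ ^ 2 * (θ₀ * (n₁ : ℝ)⁻¹) + τ) + θ₀ * (n₁ : ℝ)⁻¹
        = ((4 / γS) ^ 2 * V₃ ^ 2 * ((2 / b) ^ 2 * V₂ ^ 2 * θ₀) + θ₀) * (n₁ : ℝ)⁻¹ + (4 / γS) ^ 2 * V₃ ^ 2 * τ := by ring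
      _ ≤ K * (n₁ : ℝ)⁻¹ + K * τ := add_le_add (mul_le_mul_of_nonneg_right hAC hn0) (mul_le_mul_of_nonneg_right hB hτ)
      _ = K * (τ + (n₁ : ℝ)⁻¹) := by ring


end Summit.QuantumFields.YangMills.BalabanUVNodes.N15.UnitLayerBgCol

end
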